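import Literature.NumberTheory.LFunctions.Zhang2022.RepairKappaProfile
import Literature.NumberTheory.LFunctions.Zhang2022.RepairFrakc12Theta
import Literature.NumberTheory.LFunctions.Zhang2022.RepairAdmissible

/-!
# Zhang (2022), repair rung F-S1R: the mollifier-pair block is the Gram form `𝔅` on the pair profile

Y. Zhang, *Discrete mean estimates and the Landau–Siegel zero*, arXiv:2211.02515v1 [Zhang2022LandauSiegel] —
an unrefereed manuscript under adjudication; **nothing here asserts any of its claims, and nothing here is a
statement about Landau–Siegel zeros.** Track K-S1 of the repair rung (RULING R3, 2026-08-26), third file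
(after `RepairFormulaIGram`, `RepairKappaProfile`).

**Result.** The θ-generic mollifier-pair block of `RepairFrakc12Theta` — `bDiagR k ν` ((8.19)/(8.20)/(9.3)/(9.4)
at a general design), `bCrossYR/bCrossXR k_L k_S ν_L ν_S` ((8.22)/(9.5), (8.21)/(9.6)), the Hermitian pair form
`pairFormR`, and the class functionals `frakc1T θ = 𝔠₁(θ)` (display after (8.23)) and `frakc2T θ = 𝔠₂(θ)`
(display after (9.7), derived prefactor) — are VALUES OF FORMULA I on the `ϰ`-profiles:
`M(ϰ_μ,ϰ_μ) = bDiagR` (`Mform_kappaP_diag`), `M(ϰ_L,ϰ_S) = bCrossYR`, `M(ϰ_S,ϰ_L) = bCrossXR` (the integral over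
`[0,1]` collapses to `[0, min(ν_a,ν_b)]` = the sum of Prop 7.1 over `n < min(P_a,P_b)`; no closed-form
antiderivative, no `k_L ≠ k_S` caveat). Hence, by the Gram identity of `RepairFormulaIGram` and sesquilinearity,
**`pairFormR k_L k_S ν_L ν_S u_L u_S = 𝔅(u_Lϰ_L + u_Sϰ_S)`** (`pairForm_eq_mainTermForm`, `𝔅 = mainTermForm`
of `MainTermFormPSD`, STRUCTURE.md (4.1)) for every `0 < ν_S ≤ ν_L ≤ 1`, `k_L, k_S ≠ 0`, `(u_L,u_S) ∈ ℂ²`, and on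
the admissible class `AdmissibleTheta` of `RepairAdmissible`:
`frakc1T θ = 𝔅(ϰ_{ν₁,k₁} + ι₂ϰ_{ν₂,k₂})`, `frakc2T θ = 𝔅(ῑ₄ϰ_{ν₂,k₂} + ῑ₃ϰ_{ν₃,k₃})`
(`frakc1T_eq_mainTermForm`, `frakc2T_eq_mainTermForm`), so **`𝔠₁(θ) ≥ 0` and `𝔠₂(θ) ≥ 0` for every admissible
design** (`frakc1T_re_nonneg`, `frakc2T_re_nonneg`, from `MainTermFormH1.mainTermForm_nonneg_of_isH1` — the PSD
theorem O15 of the pub-zhang cell); at the printed design the certified constants `𝔠₁ = 7.0501…`,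
`𝔠₂ = 6.9870…` are these `𝔅`-values (`frakc1_eq_mainTermForm`, `frakc2c_eq_mainTermForm`).

**Role (K-S1 of the structural Q2 theorem).** With the analogous identifications of the tent constant
`C₂₃₃(θ) = 𝔅(f_θ)` and of the cross terms `2Re 𝔠₃(θ)`, `𝔡′+𝔡` with polar values (K-S2/K-S3, other files), the
abstract Cauchy–Schwarz wall `MainTermFormCauchySchwarz.not_closing_of_isH1` applies to every admissible design:
the §2 endgame's true need `C₂₃₂·C₂₃₃ < |𝔡′+𝔡|²` is unattainable in class. This file supplies the `𝔠₁ + 𝔠₂`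
slots and their `H¹` witnesses (`kinkedProfile_h1Profile`, `kinkedProfile_h2Profile`). Elementary calculus;
`[cite: Zhang2022LandauSiegel, (2.27), (8.23), (9.7)]` tags except for transcribed displays.
-/

noncomputable section

open Complex Real ComplexConjugate Set MeasureTheory intervalIntegral

namespace Literature.NumberTheory.LFunctions.Zhang2022

namespace Repair

/-! ### Formula I on two `ϰ`-profiles is the displayed pair integral -/

section PairBlock

variable {νa νb ka kb : ℝ}

/-- On the common support the dipole integrand of two `ϰ`-profiles is `(ν_aν_b)⁻¹ 𝔣𝔣_{j,k_a}(ν_a−y)𝔤𝔥_{j,k_b}(ν_b−y)`.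
[cite: Zhang2022LandauSiegel, (8.11)–(8.12)] -/
theorem dipoleIntegrand_kappaP_of_lt (ha : 0 < νa) (hb : 0 < νb) (hb1 : νb ≤ 1) (hkb : kb ≠ 0)
    (j : ℕ) {y : ℝ} (hya : y < νa) (hyb : y < νb) :
    dipoleIntegrand j (kappaP νa ka) (kappaP' νa ka) (kappaP νb kb) (kappaP' νb kb) y
      = (((1 / (νa * νb) : ℝ)) : ℂ) * (ffT ka j (νa - y) * ghT kb j (νb - y)) := by
  unfold dipoleIntegrand
  rw [kappaP'_add_eq_ffT ha.ne' j hya, conj_kappa_gside_eq_ghT hkb hb hb1 j hyb]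
  push_cast
  ring

/-- Off the common support the dipole integrand of two `ϰ`-profiles vanishes (on `[min ν, 1]`). [cite: Zhang2022LandauSiegel, (2.27), (8.23), (9.7)] -/
theorem dipoleIntegrand_kappaP_of_ge (ha : 0 < νa) (hb : 0 < νb) (j : ℕ) {y : ℝ}
    (hy : min νa νb ≤ y) (hy1 : y ≤ 1) :
    dipoleIntegrand j (kappaP νa ka) (kappaP' νa ka) (kappaP νb kb) (kappaP' νb kb) y = 0 := by
  unfold dipoleIntegrand
  rcases le_total νa νb with hab | hab
  · rw [min_eq_left hab] at hy
    rw [kappaP'_of_ge hy, kappaP_of_ge ha.ne' hy]; ring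
  · rw [min_eq_right hab] at hy
    rw [kappaP'_of_ge hy, kappaP_of_ge hb.ne' hy, integral_kappaP_tail_of_ge hb hy hy1]
    simp

/-- The pairing integral of two components: `∫₀¹` of the dipole integrand is
`(ν_aν_b)⁻¹ ∫₀^{min(ν_a,ν_b)} 𝔣𝔣_{j,k_a}(ν_a−u)𝔤𝔥_{j,k_b}(ν_b−u) du` (the sum of Prop 7.1 runs over
`n < min(P_a, P_b)`). [cite: Zhang2022LandauSiegel, (8.11)–(8.12)] -/
theorem integral_dipoleIntegrand_kappaP (ha : 0 < νa) (hb : 0 < νb) (ha1 : νa ≤ 1) (hb1 : νb ≤ 1)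
    (hkb : kb ≠ 0) (j : ℕ) :
    ∫ y in (0:ℝ)..1, dipoleIntegrand j (kappaP νa ka) (kappaP' νa ka) (kappaP νb kb) (kappaP' νb kb) y
      = (((1 / (νa * νb) : ℝ)) : ℂ) *
          ∫ u in (0:ℝ)..min νa νb, ffT ka j (νa - u) * ghT kb j (νb - u) := by
  set m := min νa νb with hm
  have hm0 : 0 ≤ m := le_min ha.le hb.le
  have hm1 : m ≤ 1 := (min_le_left _ _).trans ha1
  have hF : Continuous fun u : ℝ => (((1 / (νa * νb) : ℝ)) : ℂ)
      * (ffT ka j (νa - u) * ghT kb j (νb - u)) := by unfold ffT ffR ghT ghR; fun_prop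
  set D := dipoleIntegrand j (kappaP νa ka) (kappaP' νa ka) (kappaP νb kb) (kappaP' νb kb)
    with hD
  have hEq : EqOn D (fun u => (((1 / (νa * νb) : ℝ)) : ℂ)
      * (ffT ka j (νa - u) * ghT kb j (νb - u))) (uIoo 0 m) := by
    intro u hu
    rw [uIoo_of_le hm0] at hu
    exact dipoleIntegrand_kappaP_of_lt ha hb hb1 hkb j (hu.2.trans_le (min_le_left _ _))
      (hu.2.trans_le (min_le_right _ _))
  have hEq0 : EqOn D (fun _ => (0:ℂ)) (uIoo m 1) := by
    intro u hu
    rw [uIoo_of_le hm1] at hu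
    exact dipoleIntegrand_kappaP_of_ge ha hb j hu.1.le hu.2.le
  have hi1 : IntervalIntegrable D volume 0 m := (hF.intervalIntegrable 0 m).congr_uIoo hEq.symm
  have hi2 : IntervalIntegrable D volume m 1 :=
    (intervalIntegrable_const (c := (0:ℂ))).congr_uIoo hEq0.symm
  rw [← intervalIntegral.integral_add_adjacent_intervals hi1 hi2,
    intervalIntegral.integral_congr_uIoo hEq, intervalIntegral.integral_congr_uIoo hEq0,
    intervalIntegral.integral_zero, add_zero, intervalIntegral.integral_const_mul]

/-- **`M(ϰ_μ, ϰ_μ) = b_μμ`**: on a single component the sesquilinear form is the diagonal entry `bDiagR k ν` of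
`RepairFrakc12Theta` ((8.19), (8.20), (9.3), (9.4) at general real `(ν, k)`).
[cite: Zhang2022LandauSiegel, (8.19)–(8.20), (9.3)–(9.4)] -/
theorem Mform_kappaP_diag {ν k : ℝ} (hν : 0 < ν) (hν1 : ν ≤ 1) (hk : k ≠ 0) :
    Mform (kappaP ν k) (kappaP' ν k) (kappaP ν k) (kappaP' ν k) = bDiagR k ν := by
  unfold Mform bDiagR
  rw [integral_dipoleIntegrand_kappaP hν hν hν1 hν1 hk, integral_dipoleIntegrand_kappaP hν hν hν1 hν1 hk,
    integral_dipoleIntegrand_kappaP hν hν hν1 hν1 hk, min_self]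
  have e : ∀ j : ℕ, (∫ u in (0:ℝ)..ν, ffT k j (ν - u) * ghT k j (ν - u))
      = ∫ z in (0:ℝ)..ν, ffT k j z * ghT k j z := by
    intro j
    have := intervalIntegral.integral_comp_sub_left (fun z => ffT k j z * ghT k j z) ν
      (a := 0) (b := ν)
    simpa using this
  rw [e, e, e]
  unfold diagIntegrandR
  have c : ∀ j : ℕ, Continuous fun z => ffT k j z * ghT k j z := by
    intro j; unfold ffT ffR ghT ghR; fun_prop
  rw [integral_wsum3 (c 1) (c 2) (c 3)]
  have hν' : (ν : ℂ) ≠ 0 := by exact_mod_cast hν.ne'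
  have hπ : (π : ℂ) ≠ 0 := by exact_mod_cast Real.pi_ne_zero
  push_cast
  field_simp

/-- **`M(ϰ_L, ϰ_S) = b_Y`**: the longer component on the `𝔣𝔣`-side, the shorter on the `𝔤𝔥`-side, is
`bCrossYR k_L k_S ν_L ν_S` of `RepairFrakc12Theta` ((8.22), (9.5) at general real `(ν, k)`; `ν_S ≤ ν_L`).
[cite: Zhang2022LandauSiegel, (8.22), (9.5)] -/
theorem Mform_kappaP_crossY {νL νS kL kS : ℝ} (hS : 0 < νS) (hSL : νS ≤ νL) (hL1 : νL ≤ 1)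
    (hkS : kS ≠ 0) :
    Mform (kappaP νL kL) (kappaP' νL kL) (kappaP νS kS) (kappaP' νS kS) = bCrossYR kL kS νL νS := by
  have hL : 0 < νL := hS.trans_le hSL
  have hS1 : νS ≤ 1 := hSL.trans hL1
  unfold Mform bCrossYR
  rw [integral_dipoleIntegrand_kappaP hL hS hL1 hS1 hkS, integral_dipoleIntegrand_kappaP hL hS hL1 hS1 hkS,
    integral_dipoleIntegrand_kappaP hL hS hL1 hS1 hkS, min_eq_right hSL]
  have e : ∀ j : ℕ, (∫ u in (0:ℝ)..νS, ffT kL j (νL - u) * ghT kS j (νS - u))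
      = ∫ z in (0:ℝ)..νS, ffT kL j (z + (νL - νS)) * ghT kS j z := by
    intro j
    have := intervalIntegral.integral_comp_sub_left
      (fun z => ffT kL j (z + (νL - νS)) * ghT kS j z) νS (a := 0) (b := νS)
    simp only [sub_self, sub_zero] at this
    rw [← this]
    refine intervalIntegral.integral_congr fun u _ => ?_
    ring_nf
  rw [e, e, e]
  unfold crossYIntegrandR
  have c : ∀ j : ℕ, Continuous fun z => ffT kL j (z + (νL - νS)) * ghT kS j z := by
    intro j; unfold ffT ffR ghT ghR; fun_prop
  rw [integral_wsum3 (c 1) (c 2) (c 3)]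
  have hL' : (νL : ℂ) ≠ 0 := by exact_mod_cast hL.ne'
  have hS' : (νS : ℂ) ≠ 0 := by exact_mod_cast hS.ne'
  have hπ : (π : ℂ) ≠ 0 := by exact_mod_cast Real.pi_ne_zero
  push_cast
  field_simp

/-- **`M(ϰ_S, ϰ_L) = b_X`**: the shorter component on the `𝔣𝔣`-side is `bCrossXR k_L k_S ν_L ν_S`
((8.21), (9.6) at general real `(ν, k)`; `ν_S ≤ ν_L`). [cite: Zhang2022LandauSiegel, (8.21), (9.6)] -/
theorem Mform_kappaP_crossX {νL νS kL kS : ℝ} (hS : 0 < νS) (hSL : νS ≤ νL) (hL1 : νL ≤ 1)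
    (hkL : kL ≠ 0) :
    Mform (kappaP νS kS) (kappaP' νS kS) (kappaP νL kL) (kappaP' νL kL) = bCrossXR kL kS νL νS := by
  have hL : 0 < νL := hS.trans_le hSL
  have hS1 : νS ≤ 1 := hSL.trans hL1
  unfold Mform bCrossXR
  rw [integral_dipoleIntegrand_kappaP hS hL hS1 hL1 hkL, integral_dipoleIntegrand_kappaP hS hL hS1 hL1 hkL,
    integral_dipoleIntegrand_kappaP hS hL hS1 hL1 hkL, min_eq_left hSL]
  have e : ∀ j : ℕ, (∫ u in (0:ℝ)..νS, ffT kS j (νS - u) * ghT kL j (νL - u))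
      = ∫ z in (0:ℝ)..νS, ffT kS j z * ghT kL j (z + (νL - νS)) := by
    intro j
    have := intervalIntegral.integral_comp_sub_left
      (fun z => ffT kS j z * ghT kL j (z + (νL - νS))) νS (a := 0) (b := νS)
    simp only [sub_self, sub_zero] at this
    rw [← this]
    refine intervalIntegral.integral_congr fun u _ => ?_
    ring_nf
  rw [e, e, e]
  unfold crossXIntegrandR
  have c : ∀ j : ℕ, Continuous fun z => ffT kS j z * ghT kL j (z + (νL - νS)) := by
    intro j; unfold ffT ffR ghT ghR; fun_prop
  rw [integral_wsum3 (c 1) (c 2) (c 3)]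
  have hL' : (νL : ℂ) ≠ 0 := by exact_mod_cast hL.ne'
  have hS' : (νS : ℂ) ≠ 0 := by exact_mod_cast hS.ne'
  have hπ : (π : ℂ) ≠ 0 := by exact_mod_cast Real.pi_ne_zero
  push_cast
  field_simp

end PairBlock

/-! ### The pair block is the Gram form of `𝔅` on the two-component profile -/

section PairForm

variable {νL νS kL kS : ℝ}

/-- The profile of a two-component mollifier `u_L ϰ_{ν_L,k_L} + u_S ϰ_{ν_S,k_S}` (`H₁`: `(u_L,u_S) = (1, ι₂)`;
`H₂`: `(ῑ₄, ῑ₃)` on `(ϰ₁₂, ϰ₁₃)`). [cite: Zhang2022LandauSiegel, (2.27)] -/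
def pairProfile (νL kL νS kS : ℝ) (uL uS : ℂ) (x : ℝ) : ℂ :=
  uL * kappaP νL kL x + uS * kappaP νS kS x

/-- Right derivative of `pairProfile`. [cite: Zhang2022LandauSiegel, (2.27), (8.23), (9.7)] -/
def pairProfile' (νL kL νS kS : ℝ) (uL uS : ℂ) (x : ℝ) : ℂ :=
  uL * kappaP' νL kL x + uS * kappaP' νS kS x

/-- `pairProfile` is a kinked profile. [cite: Zhang2022LandauSiegel, (2.27), (8.23), (9.7)] -/
theorem kinkedProfile_pairProfile (hS : 0 < νS) (hSL : νS ≤ νL) (hL1 : νL ≤ 1) (uL uS : ℂ) :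
    KinkedProfile (pairProfile νL kL νS kS uL uS) (pairProfile' νL kL νS kS uL uS) :=
  ((kinkedProfile_kappaP (k := kL) (hS.trans_le hSL) hL1).smul uL).add_smul
    (kinkedProfile_kappaP (k := kS) hS (hSL.trans hL1)) uS

/-- **The mollifier-pair block is `𝔅` on the pair profile**: for every design
`0 < ν_S ≤ ν_L ≤ 1`, `k_L, k_S ≠ 0`, `(u_L, u_S) ∈ ℂ²`, p3's Hermitian pair form (the main-order constant of
`2Re Θ₁` for the pair: `𝔠₁(θ) = frakc1T θ = pairFormR k₁ k₂ ν₁ ν₂ 1 ι₂`, `𝔠₂(θ) = frakc2T θ = pairFormR k₂ k₃ ν₂ ν₃ ῑ₄ ῑ₃`,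
`RepairFrakc12Theta`) equals the tree's PSD
main-term form `𝔅(g,g)` on `g = u_Lϰ_L + u_Sϰ_S`. [cite: Zhang2022LandauSiegel, §8 (8.23), §9 (9.7)] -/
theorem pairForm_eq_mainTermForm (hS : 0 < νS) (hSL : νS ≤ νL) (hL1 : νL ≤ 1) (hkL : kL ≠ 0)
    (hkS : kS ≠ 0) (uL uS : ℂ) :
    pairFormR kL kS νL νS uL uS
      = (mainTermForm (pairProfile νL kL νS kS uL uS) (pairProfile' νL kL νS kS uL uS) : ℂ) := by
  have hL : 0 < νL := hS.trans_le hSL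
  have hS1 : νS ≤ 1 := hSL.trans hL1
  have kPL := kinkedProfile_kappaP (k := kL) hL hL1
  have kPS := kinkedProfile_kappaP (k := kS) hS hS1
  have hHL := kPL.isH1
  have hHS := kPS.isH1
  have hL0 : kappaP νL kL 1 = 0 := kappaP_one hL hL1
  have hS0 : kappaP νS kS 1 = 0 := kappaP_one hS hS1
  -- the Gram identities for the four pairs
  have gLL := mainTermFormPolar_eq_Mform kPL kPL hL0 hL0
  have gLS := mainTermFormPolar_eq_Mform kPL kPS hL0 hS0
  have gSS := mainTermFormPolar_eq_Mform kPS kPS hS0 hS0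
  rw [Mform_kappaP_diag hL hL1 hkL] at gLL
  rw [Mform_kappaP_crossY hS hSL hL1 hkS, Mform_kappaP_crossX hS hSL hL1 hkL] at gLS
  rw [Mform_kappaP_diag hS hS1 hkS] at gSS
  -- expand `s(g,g)` by sesquilinearity
  have huL : IsH1OnUnitInterval (fun x => uL * kappaP νL kL x) (fun x => uL * kappaP' νL kL x) :=
    (kPL.smul uL).isH1
  have hg : IsH1OnUnitInterval (pairProfile νL kL νS kS uL uS) (pairProfile' νL kL νS kS uL uS) :=
    (kinkedProfile_pairProfile hS hSL hL1 uL uS).isH1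
  have e1 : mainTermFormSesq (pairProfile νL kL νS kS uL uS) (pairProfile' νL kL νS kS uL uS)
        (pairProfile νL kL νS kS uL uS) (pairProfile' νL kL νS kS uL uS)
      = uL * conj uL * mainTermFormSesq (kappaP νL kL) (kappaP' νL kL) (kappaP νL kL) (kappaP' νL kL)
        + uL * conj uS * mainTermFormSesq (kappaP νL kL) (kappaP' νL kL) (kappaP νS kS) (kappaP' νS kS)
        + uS * conj uL * mainTermFormSesq (kappaP νS kS) (kappaP' νS kS) (kappaP νL kL) (kappaP' νL kL)
        + uS * conj uS * mainTermFormSesq (kappaP νS kS) (kappaP' νS kS) (kappaP νS kS) (kappaP' νS kS) := by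
    have a1 := mainTermFormSesq_add_smul_left huL hHS hg uS
    have a2 := mainTermFormSesq_smul_left hHL hg uL
    have a3 := mainTermFormSesq_add_smul_right hHL huL hHS uS
    have a4 := mainTermFormSesq_smul_right hHL hHL uL
    have a5 := mainTermFormSesq_add_smul_right hHS huL hHS uS
    have a6 := mainTermFormSesq_smul_right hHS hHL uL
    unfold pairProfile pairProfile' at a1 a2 ⊢
    beta_reduce at a1 a3 a5
    rw [a1, a2, a3, a4, a5, a6]
    ring
  rw [← mainTermFormPolar_self]
  unfold mainTermFormPolar at gLL gLS gSS ⊢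
  unfold pairFormR cDiagR cCrossR
  rw [e1, ← gLL, ← gLS, ← gSS]
  simp only [map_add, map_mul, map_div₀, Complex.conj_conj, map_ofNat]
  rw [← Complex.mul_conj uL, ← Complex.mul_conj uS]
  ring

/-- **Positivity of the pair block on the whole class**: `0 ≤ Re pairForm` for every design — in
particular `𝔠₁(θ) ≥ 0` and `𝔠₂(θ) ≥ 0` for ALL admissible lengths, twists and coefficients (tree:
`MainTermFormH1.mainTermForm_nonneg_of_isH1`, the PSD theorem O15 of the pub-zhang cell).
[cite: Zhang2022LandauSiegel, §8 (8.23), §9 (9.7)] -/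
theorem pairForm_re_nonneg (hS : 0 < νS) (hSL : νS ≤ νL) (hL1 : νL ≤ 1) (hkL : kL ≠ 0) (hkS : kS ≠ 0)
    (uL uS : ℂ) : 0 ≤ (pairFormR kL kS νL νS uL uS).re := by
  rw [pairForm_eq_mainTermForm hS hSL hL1 hkL hkS, Complex.ofReal_re]
  exact mainTermForm_nonneg_of_isH1 (kinkedProfile_pairProfile hS hSL hL1 uL uS).isH1

end PairForm

/-! ### The class functionals `𝔠₁(θ)`, `𝔠₂(θ)` are `𝔅`-values on the admissible class -/

section ClassFunctionals

variable {θ : Theta}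

/-- The profile of `H₁ = H₁₁ + ι₂H₁₂` ((2.27)) at the design `θ`: `ϰ_{ν₁,k₁} + ι₂ϰ_{ν₂,k₂}`.
[cite: Zhang2022LandauSiegel, (2.23), (2.24), (2.27)] -/
def h1Profile (θ : Theta) : ℝ → ℂ := pairProfile θ.nu1 θ.k1 θ.nu2 θ.k2 1 θ.iota2
/-- Right derivative of `h1Profile`. [cite: Zhang2022LandauSiegel, (2.27), (8.23), (9.7)] -/
def h1Profile' (θ : Theta) : ℝ → ℂ := pairProfile' θ.nu1 θ.k1 θ.nu2 θ.k2 1 θ.iota2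

/-- The profile of `H₂ = ῑ₃H₁₃ + ῑ₄H₁₂` ((2.27)) at the design `θ`, longer component first:
`ῑ₄ϰ_{ν₂,k₂} + ῑ₃ϰ_{ν₃,k₃}`. [cite: Zhang2022LandauSiegel, (2.24), (2.25), (2.27)] -/
def h2Profile (θ : Theta) : ℝ → ℂ := pairProfile θ.nu2 θ.k2 θ.nu3 θ.k3 (conj θ.iota4) (conj θ.iota3)
/-- Right derivative of `h2Profile`. [cite: Zhang2022LandauSiegel, (2.27), (8.23), (9.7)] -/
def h2Profile' (θ : Theta) : ℝ → ℂ := pairProfile' θ.nu2 θ.k2 θ.nu3 θ.k3 (conj θ.iota4) (conj θ.iota3)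

/-- The length/shift inequalities of the admissible class used here. [cite: Zhang2022LandauSiegel, (2.27), (8.23), (9.7)] -/
private theorem AdmissibleTheta.pair_bounds (h : AdmissibleTheta θ) :
    0 < θ.nu3 ∧ θ.nu3 ≤ θ.nu2 ∧ θ.nu2 ≤ θ.nu1 ∧ θ.nu2 ≤ 1 ∧ θ.nu1 ≤ 1
      ∧ θ.k1 ≠ 0 ∧ θ.k2 ≠ 0 ∧ θ.k3 ≠ 0 := by
  obtain ⟨⟨h32, h21⟩, -, h1, h13, -, ⟨⟨hk1, -⟩, ⟨hk2, -⟩, ⟨hk3, -⟩⟩, -⟩ := h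
  unfold Theta.belowP at h1
  unfold Theta.dualRangesNonempty at h13
  exact ⟨by linarith, h32.le, h21.le, by linarith, h1.le, hk1.ne', hk2.ne', hk3.ne'⟩

/-- `H₁`'s profile is an `H¹` (kinked) profile on the admissible class. [cite: Zhang2022LandauSiegel, (2.27), (8.23), (9.7)] -/
theorem kinkedProfile_h1Profile (h : AdmissibleTheta θ) : KinkedProfile (h1Profile θ) (h1Profile' θ) := by
  obtain ⟨h3, h32, h21, h2le, h1le, -, -, -⟩ := h.pair_bounds
  exact kinkedProfile_pairProfile (h3.trans_le h32) h21 h1le 1 θ.iota2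

/-- `H₂`'s profile is an `H¹` (kinked) profile on the admissible class. [cite: Zhang2022LandauSiegel, (2.27), (8.23), (9.7)] -/
theorem kinkedProfile_h2Profile (h : AdmissibleTheta θ) : KinkedProfile (h2Profile θ) (h2Profile' θ) := by
  obtain ⟨h3, h32, h21, h2le, -, -, -, -⟩ := h.pair_bounds
  exact kinkedProfile_pairProfile h3 h32 h2le (conj θ.iota4) (conj θ.iota3)

/-- **`𝔠₁(θ) = 𝔅(H₁-profile)`** on the admissible class: the class functional `frakc1T` of
`RepairFrakc12Theta` (= the printed `𝔠₁` at `θ₀`, `frakc1T_theta0`) is the PSD main-term form on the profile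
`ϰ_{ν₁,k₁} + ι₂ϰ_{ν₂,k₂}`. [cite: Zhang2022LandauSiegel, §8 (8.23) p.50] -/
theorem frakc1T_eq_mainTermForm (h : AdmissibleTheta θ) :
    frakc1T θ = (mainTermForm (h1Profile θ) (h1Profile' θ) : ℂ) := by
  obtain ⟨h3, h32, h21, h2le, h1le, hk1, hk2, -⟩ := h.pair_bounds
  exact pairForm_eq_mainTermForm (h3.trans_le h32) h21 h1le hk1 hk2 1 θ.iota2

/-- **`𝔠₂(θ) = 𝔅(H₂-profile)`** on the admissible class (`frakc2T`, the derived-prefactor reading of (9.5)/(9.6);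
`= frakc2c` at `θ₀`). [cite: Zhang2022LandauSiegel, §9 (9.7) p.52] -/
theorem frakc2T_eq_mainTermForm (h : AdmissibleTheta θ) :
    frakc2T θ = (mainTermForm (h2Profile θ) (h2Profile' θ) : ℂ) := by
  obtain ⟨h3, h32, h21, h2le, -, -, hk2, hk3⟩ := h.pair_bounds
  exact pairForm_eq_mainTermForm h3 h32 h2le hk2 hk3 (conj θ.iota4) (conj θ.iota3)

/-- **`𝔠₁(θ) ≥ 0` on the whole admissible class** (all lengths, shifts, `ι₂`). [cite: Zhang2022LandauSiegel, §8 (8.23) p.50] -/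
theorem frakc1T_re_nonneg (h : AdmissibleTheta θ) : 0 ≤ (frakc1T θ).re := by
  rw [frakc1T_eq_mainTermForm h, Complex.ofReal_re]
  exact mainTermForm_nonneg_of_isH1 (kinkedProfile_h1Profile h).isH1

/-- **`𝔠₂(θ) ≥ 0` on the whole admissible class** (all lengths, shifts, `ι₃, ι₄`). [cite: Zhang2022LandauSiegel, §9 (9.7) p.52] -/
theorem frakc2T_re_nonneg (h : AdmissibleTheta θ) : 0 ≤ (frakc2T θ).re := by
  rw [frakc2T_eq_mainTermForm h, Complex.ofReal_re]
  exact mainTermForm_nonneg_of_isH1 (kinkedProfile_h2Profile h).isH1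

/-- Regression at the printed design: the tree's certified constant `𝔠₁ = 7.0501…` of (8.23) IS `𝔅` of the
printed `H₁`-profile. [cite: Zhang2022LandauSiegel, §8 (8.23) p.50] -/
theorem frakc1_eq_mainTermForm : frakc1 = (mainTermForm (h1Profile theta0) (h1Profile' theta0) : ℂ) := by
  rw [← frakc1T_theta0]; exact frakc1T_eq_mainTermForm admissible_theta0

/-- Regression at the printed design: `𝔠₂ = 6.9870…` ((9.7), derived prefactor, `frakc2c`) IS `𝔅` of the
printed `H₂`-profile. [cite: Zhang2022LandauSiegel, §9 (9.7) p.52] -/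
theorem frakc2c_eq_mainTermForm : frakc2c = (mainTermForm (h2Profile theta0) (h2Profile' theta0) : ℂ) := by
  rw [← frakc2T_theta0]; exact frakc2T_eq_mainTermForm admissible_theta0

end ClassFunctionals

end Repair

end Literature.NumberTheory.LFunctions.Zhang2022
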